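import Summits.QuantumFields.YangMills.Theorems.FluctuationComparisonRegPrIntLS2BetaSourceRowEnergySplit
import Summits.QuantumFields.YangMills.Theorems.FluctuationComparisonRegPrIntLS2BetaGeodesicJensenLift
import Summits.QuantumFields.YangMills.Theorems.FluctuationComparisonRegPrIntLS2BetaCurlBudgetJunctionShare
import Literature.MathematicalPhysics.QuantumFieldTheory.Balaban1983to89.B10StarCount
import Literature.MathematicalPhysics.QuantumFieldTheory.Balaban1983to89.BlockAveragingEMLProp2
import Literature.MathematicalPhysics.QuantumFieldTheory.Balaban1983to89.LatticeFieldCalculus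
import Mathlib.Algebra.Order.Chebyshev
import HarnessLib

/-!
# S2β · (SCT″-c)₁ (JNC-E) — «THE 0→1 JUNCTION ENERGY `E_J` OF ✓`Bsrc_split_le`, BY KERNEL — AND ITS WEIGHT»: for ANY chart tower `X` with finest sizes
# `‖X 0 b‖ ≤ M₀ ≤ 1∕4` and ANY weights, the third energy of ✓p839415 obeys `E_J ≤ 2304·w(1)·L^{K−J−2}·L·M₀²·Σ_{b : PBond (F.P K) 0} ‖X 0 b‖²`;
# at the naked tower of ✓`linBudget_of_chartTower` this is `(2304·w(1)·M₀²·L^{K−J−2}·L·L^{K−J})·purse` — a purse-share iff `w(1)·M₀²·L^{2(K−J)}` is K-uniform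

Cell `ym3-torus` (YM ladder rung R3 = continuum `SU(2)` Yang–Mills on the three-torus at fixed lattice data — a RUNG: NOT d = 4, NOT infinite volume,
NOT a mass gap, NOT Clay).  Width seat «width 21» `ym3-torus-px21` (gen 26), FREE px helper on crux `stmt-QuantumFields-20520`
(`…Theses.UnitScaleTilt.FluctuationComparisonRegPrIntL`), LINE g18-1 S2β.  ✓`…CurlBudgetOfChartTowerSup` «WHAT IS LEFT: the `0 → 1` junction's energy …
(SUP-DECAY)₀, px12∕px21»; px10 g26 SPEC (SRC-E) 2026-09-01T00:49:48Z («E_junc (level 1 only) ⇔ (SUP-DECAY)₀»); desk №707 R4 («E_R, E_J ⟸ (REG)@representative»).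
`--kind proof --supports stmt-QuantumFields-20520 --as helper`, count-neutral, DEFINITION-FREE (0 `def`, 0 `instance`, 0 `notation`, 0 `sorry`, default heartbeats).

WHAT IS PROVED (sorry-free).  §1 (generic `P : Params`, level `j`, standing range `j+1 ≤ m+K`): private counting helpers (shift injectivity, the block∕offset
partition `Σ_{y′}Σ_r g(blockSite y′ r) = Σ_x g x` via lit ✓`B10StarCount.sum_block`, `|Idx| = L^d·|Perm × Perm|`) and ★`sum_sq_idxAvg_le`: for every real `f`,
`Σ_{y′ : Site P (j+1)} (|Idx|⁻¹·Σ_{a ∈ Idx × range L × range L} f(blockSite y′ a.1.1 + a.2.1 e_μ + a.2.2 e_ν))² ≤ L⁴·(L^d)⁻¹·Σ_{x : Site P j} f x²` — Cauchy–Schwarz over the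
`|Idx|·L²` summands, the `(σ,σ′)`-marginal, the bijections (the sharp `L^{4−d}`, not the crude `L⁴`).  §2 ★`sq_expRem_le` (four sizes in `[0, M₀]`, `4M₀ ≤ 1`:
`(e^S − 1 − S)² ≤ 64·M₀²·(a²+b²+c²+e²)`, Mathlib ✓`Real.abs_exp_sub_one_sub_id_le`); ★`sum_sq_rem_le`: `Σ_μΣ_νΣ_x (e^{S_{μν}(x)} − 1 − S_{μν}(x))² ≤ 256·d·M₀²·Σ_b n(b)²`
(each of the four bond slots is `d`-to-one onto `PBond`, lit ✓`bondEquiv`∕✓`shiftEquiv`).  §3 ★★★**`junctionEnergy_le (X) (w) (hw : 0 ≤ w 1) (M₀) (hM0 : ∀ b, ‖X 0 b‖ ≤ M₀)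
(hM4 : 4M₀ ≤ 1)`**: ✓p839415 `Bsrc_split_le`'s THIRD summand (text VERBATIM — `3·Σ_{i<K−J} w(i+1)·L^{K−J−1−(i+1)}·Σ_μΣ_νΣ_{y′}(𝟙[i=0]·|Idx|⁻¹Σ_a rem(i, pos_a y′))²`)
`≤ 3·(w 1·L^{K−J−1−1}·(L⁴·(L³)⁻¹·(256·3·M₀²·Σ_{b : PBond (F.P K) 0} ‖X 0 b‖²)))` (only `i = 0` survives; `d = 3`).  §4 ★`norm_chartTower_zero_le` (at ✓`linBudget_of_chartTower`'s
`hXdef`, `‖X 0 ℓ‖ ≤ ‖ζ ℓ‖`: `Ū⁰ = id`, `e^ζU₀·U₀⁻¹ = e^ζ`, ✓`norm_chartPoint`, ✓`norm_logVec_su2Quat_expPoint_le`); ★★`junctionEnergy_le_purse (hXdef) (w) (M₀) (hζM : ‖ζ ℓ‖ ≤ M₀)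
(hM4)`: `E_J ≤ (2304·w(1)·M₀²·(L^{K−J−1−1}·L·L^{K−J}))·purse`, `purse := (L⁻¹)^{K−J}·Σ_ℓ‖ζ ℓ‖² + L^{K−J}·Σ_p(1 − reTr((P_{U₀} p)⁻¹·P_{e^ζU₀} p))` (✓p838848∕✓`hP_of_chartTower`'s text).

THE WEIGHT (the point; GUIDANCE arithmetic on the displayed texts, now over a kernel inequality).  `E_J∕purse ∝ w(1)·M₀²·L^{2(K−J)−1}`.  Even at the STRONGEST
(SUP-DECAY)₀ — a representative with `M₀ ≤ c·(L⁻¹)^{K−J}` (plan (3): «E_J ⟸ (REG)@representative», Thm 2's `ζ = ηA`, `|A| ≤ c`) — the SPEC's weight `w 1 = L^{K−J−2}`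
(`w j := L^{K−J−1−j}`) leaves `E_J ≤ 2304·c²·L^{K−J−3}·purse`: NOT K-uniform; with **`w 1 := 1`** (all other `w j` unchanged; `W = Σ_j (w j)⁻¹ ≤ 1 + L∕(L−1) ≤ 3`
instead of `2`) it is `≤ 2304·c²·L⁻¹·purse`.  `E_lin`∕`E_R` only improve under the smaller `w(1)` (their `i = 0` rows carry `w(1)·L^{K−J−2}`; ✓p839746 `Elin_le_Sprime`∕(V2)
stay valid as upper bounds after a one-line weight comparison); the price is `W: 2 → 3` in ✓`hP_of_chartTower`'s `C_P = 2κ²νC_b(4∕L + W·Csrc)`, `β_P = 2κ²νC_b·W·βsrc`.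
WITHOUT a representative (window `M₀ ≤ 1∕4` only) no weight saves `E_J` (`w(1) ≲ L^{1−2(K−J)}` would force `W ≥ L^{2(K−J)−1}`): `E_J` is (REG)-class, as plan (3) files it.

HONEST SCOPE.  Finite lattice bookkeeping and one real inequality over displayed texts; `X`, `w`, `M₀` are FREE; (SUP-DECAY)₀ ∕ the representative's `M₀`, (REG),
(RES-u), the c₁ knit are HYPOTHESES or others'; nothing of Bałaban's renormalisation-group analysis is asserted or proved ([Balaban1985Averaging] (2)–(3) p.17,
(19)–(20) p.21, Prop. 4 (128)–(135) pp.37–38; [Balaban1987RG1] (0.3)–(0.4), (0.11) pp.252–253 are the printed rows these letters transcribe); GAP♯∘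
(`stub_uniformFibreGapOrbit`, registry `Lines/semiclassical_s2beta.lean` 3732b7df UNTOUCHED, 0∕5), S2β, the five registered stubs, crux 20520, 19936, 19200 and
`YM3TorusSU2` are NOT proved; no registered stub is closed; rung R3 = SU(2) YM₃ on T³ at fixed lattice data — NOT d = 4, NOT infinite volume, NOT a mass gap,
NOT Clay; the Yang–Mills mass gap is NOT proved.
-/

set_option autoImplicit false

noncomputable section

open scoped Matrix.Norms.L2Operator
open Finset

namespace Summit.QuantumFields.YangMills.Theorems.FluctuationComparisonRegPrIntLS2BetaJunctionEnergy

open Literature.MathematicalPhysics.QuantumFieldTheory.Balaban1983to89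
open Literature.MathematicalPhysics.QuantumFieldTheory.Balaban1983to89.T4Continuum
open Literature.MathematicalPhysics.QuantumFieldTheory.Balaban1983to89.T3ContinuumYM3Torus
open Literature.MathematicalPhysics.QuantumFieldTheory.Balaban1983to89.HaarExponentialChart
open Literature.MathematicalPhysics.QuantumFieldTheory.Balaban1983to89.BlockAveraging (Idx)
open Literature.MathematicalPhysics.QuantumFieldTheory.Balaban1983to89.B10Eq47AxialChi (shiftN)

/-! ## §1 Lattice counting: shifted block parametrisations and the `Idx`-average -/

section Count

variable {P : Params} {j : ℕ}

/-- The `m`-fold shift in direction `μ` is injective on the sites of `T^{(j)}`. [folklore] -/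
private theorem shiftN_injective (μ : Fin P.d) (m : ℕ) : Function.Injective (fun x : Site P j => shiftN x μ m) := by
  intro x x' h
  funext κ
  have h' := congrFun h κ
  simp only [BlockAveragingEMLProp2.shiftN_apply] at h'
  exact add_right_cancel h'

/-- Re-indexing a full sum by an injective self-map of a finite type. [folklore] -/
private theorem sum_comp_eq_of_injective {ι : Type*} [Fintype ι] {M : Type*} [AddCommMonoid M]
    (φ : ι → ι) (hφ : Function.Injective φ) (g : ι → M) : ∑ x, g (φ x) = ∑ x, g x :=
  (Equiv.ofBijective φ (Finite.injective_iff_bijective.mp hφ)).sum_comp g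

/-- A full sum is invariant under the double shift `x ↦ x + s e_μ + s′ e_ν`. [folklore] -/
private theorem sum_comp_shiftN_shiftN {M : Type*} [AddCommMonoid M] (g : Site P j → M) (μ ν : Fin P.d) (s s' : ℕ) :
    ∑ x : Site P j, g (shiftN (shiftN x μ s) ν s') = ∑ x : Site P j, g x :=
  sum_comp_eq_of_injective (fun x : Site P j => shiftN (shiftN x μ s) ν s')
    ((shiftN_injective ν s').comp (shiftN_injective μ s)) g

/-- **The blocks partition the fine torus, each parametrised by its offsets**: `Σ_{y′} Σ_r g(blockSite y′ r) = Σ_x g x` (standing range). [cite: Balaban1987RG1, (0.3) p.252] -/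
private theorem sum_sum_blockSite (hj : j + 1 ≤ P.m + P.K) {M : Type*} [AddCommMonoid M] (g : Site P j → M) :
    ∑ y' : Site P (j + 1), ∑ r : Fin P.d → Fin P.L, g (Site.blockSite y' r) = ∑ x : Site P j, g x := by
  have h := Finset.sum_fiberwise (Finset.univ : Finset (Site P j)) (fun x => blockOf x) g
  rw [← h]
  refine Finset.sum_congr rfl fun y' _ => ?_
  rw [← B10StarCount.sum_block hj y' g]
  rfl

/-- `|Idx P| = L^d · |Perm × Perm|`. [folklore] -/
private theorem card_Idx : Fintype.card (Idx P) = P.L ^ P.d * Fintype.card (Equiv.Perm (Fin P.d) × Equiv.Perm (Fin P.d)) := by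
  rw [Fintype.card_prod, Fintype.card_fun, Fintype.card_fin, Fintype.card_fin]

/-- ★ **THE `Idx`-AVERAGE COUNT** (the sharp `L^{4−d}`): for every `f` on the sites of `T^{(j)}` and directions `μ, ν`,
`Σ_{y′ : Site P (j+1)} (|Idx|⁻¹·Σ_{a ∈ Idx × range L × range L} f(blockSite y′ a.1.1 + a.2.1 e_μ + a.2.2 e_ν))² ≤ L⁴·(L^d)⁻¹·Σ_{x : Site P j} f x²`
— Cauchy–Schwarz over the `|Idx|·L²` summands, the `(σ,σ′)`-marginal, then the block/shift bijections. [cite: Balaban1985Averaging, (2)-(3) p.17; Balaban1987RG1, (0.3)-(0.4) p.252-253] -/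
theorem sum_sq_idxAvg_le (hj : j + 1 ≤ P.m + P.K) (μ ν : Fin P.d) (f : Site P j → ℝ) :
    ∑ y' : Site P (j + 1), (((Fintype.card (Idx P) : ℝ))⁻¹ *
        ∑ a ∈ (Finset.univ : Finset (Idx P)) ×ˢ (Finset.range P.L ×ˢ Finset.range P.L),
          f (shiftN (shiftN (Site.blockSite y' a.1.1) μ a.2.1) ν a.2.2)) ^ 2 ≤
      (P.L : ℝ) ^ 4 * ((P.L : ℝ) ^ P.d)⁻¹ * ∑ x : Site P j, f x ^ 2 := by
  classical
  set N : ℕ := Fintype.card (Idx P) with hN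
  set B : ℕ := Fintype.card (Equiv.Perm (Fin P.d) × Equiv.Perm (Fin P.d)) with hB
  have hNB : N = P.L ^ P.d * B := card_Idx
  have hL : (0 : ℝ) < (P.L : ℝ) := by exact_mod_cast P.L_pos
  have hB0 : (0 : ℝ) < (B : ℝ) := by
    have : 0 < B := Fintype.card_pos
    exact_mod_cast this
  have hN0 : (0 : ℝ) < (N : ℝ) := by rw [hNB]; push_cast; positivity
  have hA : ((Finset.univ : Finset (Idx P)) ×ˢ (Finset.range P.L ×ˢ Finset.range P.L)).card = N * (P.L * P.L) := by
    rw [Finset.card_product, Finset.card_product, Finset.card_range, Finset.card_univ]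
  -- Cauchy–Schwarz pointwise in `y'`
  have hCS : ∀ y' : Site P (j + 1), (((N : ℝ))⁻¹ *
        ∑ a ∈ (Finset.univ : Finset (Idx P)) ×ˢ (Finset.range P.L ×ˢ Finset.range P.L),
          f (shiftN (shiftN (Site.blockSite y' a.1.1) μ a.2.1) ν a.2.2)) ^ 2 ≤
      ((P.L : ℝ) ^ 2 * ((N : ℝ))⁻¹) *
        ∑ a ∈ (Finset.univ : Finset (Idx P)) ×ˢ (Finset.range P.L ×ˢ Finset.range P.L),
          f (shiftN (shiftN (Site.blockSite y' a.1.1) μ a.2.1) ν a.2.2) ^ 2 := by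
    intro y'
    have h := sq_sum_le_card_mul_sum_sq (s := (Finset.univ : Finset (Idx P)) ×ˢ (Finset.range P.L ×ˢ Finset.range P.L))
      (f := fun a => f (shiftN (shiftN (Site.blockSite y' a.1.1) μ a.2.1) ν a.2.2))
    rw [hA] at h
    rw [mul_pow]
    have hNinv : ((N : ℝ))⁻¹ ^ 2 * ((N * (P.L * P.L) : ℕ) : ℝ) = (P.L : ℝ) ^ 2 * ((N : ℝ))⁻¹ := by
      push_cast
      field_simp
    calc ((N : ℝ))⁻¹ ^ 2 * (∑ a ∈ (Finset.univ : Finset (Idx P)) ×ˢ (Finset.range P.L ×ˢ Finset.range P.L),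
          f (shiftN (shiftN (Site.blockSite y' a.1.1) μ a.2.1) ν a.2.2)) ^ 2
        ≤ ((N : ℝ))⁻¹ ^ 2 * (((N * (P.L * P.L) : ℕ) : ℝ) * ∑ a ∈ (Finset.univ : Finset (Idx P)) ×ˢ (Finset.range P.L ×ˢ Finset.range P.L),
          f (shiftN (shiftN (Site.blockSite y' a.1.1) μ a.2.1) ν a.2.2) ^ 2) :=
          mul_le_mul_of_nonneg_left h (by positivity)
      _ = _ := by rw [← mul_assoc, hNinv]
  refine (Finset.sum_le_sum fun y' _ => hCS y').trans ?_
  rw [← Finset.mul_sum]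
  -- the inner double sum, level by level: `(σ,σ′)`-marginal, then the block / shift bijections
  have hinner : ∑ y' : Site P (j + 1), ∑ a ∈ (Finset.univ : Finset (Idx P)) ×ˢ (Finset.range P.L ×ˢ Finset.range P.L),
        f (shiftN (shiftN (Site.blockSite y' a.1.1) μ a.2.1) ν a.2.2) ^ 2 =
      (B : ℝ) * ((P.L * P.L : ℕ) : ℝ) * ∑ x : Site P j, f x ^ 2 := by
    have step1 : ∀ y' : Site P (j + 1), ∑ a ∈ (Finset.univ : Finset (Idx P)) ×ˢ (Finset.range P.L ×ˢ Finset.range P.L),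
        f (shiftN (shiftN (Site.blockSite y' a.1.1) μ a.2.1) ν a.2.2) ^ 2 =
        ∑ ss ∈ Finset.range P.L ×ˢ Finset.range P.L, (B : ℝ) * ∑ r : Fin P.d → Fin P.L,
          f (shiftN (shiftN (Site.blockSite y' r) μ ss.1) ν ss.2) ^ 2 := by
      intro y'
      rw [Finset.sum_product, Finset.sum_comm]
      refine Finset.sum_congr rfl fun ss _ => ?_
      rw [← Finset.univ_product_univ, Finset.sum_product]
      simp only [Finset.sum_const, Finset.card_univ, hB, nsmul_eq_mul]
      rw [Finset.mul_sum]
    simp_rw [step1]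
    rw [Finset.sum_comm]
    have step2 : ∀ ss : ℕ × ℕ, ∑ y' : Site P (j + 1), (B : ℝ) * ∑ r : Fin P.d → Fin P.L,
          f (shiftN (shiftN (Site.blockSite y' r) μ ss.1) ν ss.2) ^ 2 = (B : ℝ) * ∑ x : Site P j, f x ^ 2 := by
      intro ss
      rw [← Finset.mul_sum, sum_sum_blockSite hj (fun x => f (shiftN (shiftN x μ ss.1) ν ss.2) ^ 2),
        sum_comp_shiftN_shiftN (fun x => f x ^ 2)]
    simp_rw [step2]
    rw [Finset.sum_const, Finset.card_product, Finset.card_range, nsmul_eq_mul]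
    push_cast
    ring
  rw [hinner, hNB]
  push_cast
  have : (P.L : ℝ) ^ 2 * ((P.L : ℝ) ^ P.d * (B : ℝ))⁻¹ * ((B : ℝ) * ((P.L : ℝ) * (P.L : ℝ)) * ∑ x : Site P j, f x ^ 2) =
      (P.L : ℝ) ^ 4 * ((P.L : ℝ) ^ P.d)⁻¹ * ∑ x : Site P j, f x ^ 2 := by
    field_simp
  rw [this]

end Count

/-! ## §2 The exponential remainder of the `0 → 1` junction: `rem = e^S − 1 − S ≤ S²` on `S ≤ 1`, `S` the four chart norms around a plaquette -/

/-- ★ Pointwise: with four sizes in `[0, M₀]`, `4M₀ ≤ 1`, the BCH-free junction remainder obeys `(e^S − 1 − S)² ≤ 64·M₀²·(a² + b² + c² + e²)`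
(Mathlib ✓`Real.abs_exp_sub_one_sub_id_le`: `|e^S − 1 − S| ≤ S²` for `|S| ≤ 1`; then `S⁴ ≤ (4M₀)²·S²` and `S² ≤ 4Σ`). [folklore] -/
theorem sq_expRem_le (a b c e M₀ : ℝ) (ha : 0 ≤ a) (hb : 0 ≤ b) (hc : 0 ≤ c) (he : 0 ≤ e)
    (haM : a ≤ M₀) (hbM : b ≤ M₀) (hcM : c ≤ M₀) (heM : e ≤ M₀) (hM4 : 4 * M₀ ≤ 1) :
    (Real.exp (a + b + c + e) - 1 - (a + b + c + e)) ^ 2 ≤ 64 * M₀ ^ 2 * (a ^ 2 + b ^ 2 + c ^ 2 + e ^ 2) := by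
  set S : ℝ := a + b + c + e with hS
  have hS0 : 0 ≤ S := by rw [hS]; positivity
  have hS4 : S ≤ 4 * M₀ := by rw [hS]; linarith
  have hS1 : |S| ≤ 1 := by rw [abs_of_nonneg hS0]; linarith
  have h1 : |Real.exp S - 1 - S| ≤ S ^ 2 := Real.abs_exp_sub_one_sub_id_le hS1
  have h2 : (Real.exp S - 1 - S) ^ 2 ≤ (S ^ 2) ^ 2 := sq_le_sq' (abs_le.mp h1).1 (abs_le.mp h1).2
  have h3 : S ^ 2 ≤ 16 * M₀ ^ 2 := by nlinarith
  have h4 : S ^ 2 ≤ 4 * (a ^ 2 + b ^ 2 + c ^ 2 + e ^ 2) := by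
    rw [hS]; nlinarith [sq_nonneg (a - b), sq_nonneg (a - c), sq_nonneg (a - e), sq_nonneg (b - c), sq_nonneg (b - e), sq_nonneg (c - e)]
  calc (Real.exp S - 1 - S) ^ 2 ≤ (S ^ 2) ^ 2 := h2
    _ = S ^ 2 * S ^ 2 := by ring
    _ ≤ (16 * M₀ ^ 2) * (4 * (a ^ 2 + b ^ 2 + c ^ 2 + e ^ 2)) := mul_le_mul h3 h4 (sq_nonneg _) (by positivity)
    _ = 64 * M₀ ^ 2 * (a ^ 2 + b ^ 2 + c ^ 2 + e ^ 2) := by ring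

section Rem

variable {P : Params} {j : ℕ}

/-- A sum over positively oriented bonds is a double sum over (site, direction) (lit ✓`bondEquiv`). [folklore] -/
private theorem sum_site_dir_eq_sum_bond {M : Type*} [AddCommMonoid M] (g : PBond P j → M) :
    ∑ x : Site P j, ∑ μ : Fin P.d, g ⟨x, μ⟩ = ∑ b : PBond P j, g b := by
  rw [← Equiv.sum_comp (LatticeFieldCalculus.bondEquiv (P := P) (j := j)) g, Fintype.sum_prod_type]
  rfl

/-- ★ **THE REMAINDER ENERGY IS `256·d·M₀²` TIMES THE CHORD ENERGY**: for bond sizes `0 ≤ n ≤ M₀`, `4M₀ ≤ 1`,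
`Σ_μ Σ_ν Σ_x (e^{S_{μν}(x)} − 1 − S_{μν}(x))² ≤ 256·d·M₀²·Σ_b n(b)²`, `S_{μν}(x) := n⟨x,μ⟩ + n⟨x+e_μ,ν⟩ + n⟨x+e_ν,μ⟩ + n⟨x,ν⟩` (each of the four bond slots is `d`-to-one).
[cite: Balaban1985Averaging, (19)-(20) p.21; Balaban1987RG1, (0.4) p.253] -/
theorem sum_sq_rem_le (n : PBond P j → ℝ) (hn0 : ∀ b, 0 ≤ n b) (M₀ : ℝ) (hn : ∀ b, n b ≤ M₀) (hM4 : 4 * M₀ ≤ 1) :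
    ∑ μ : Fin P.d, ∑ ν : Fin P.d, ∑ x : Site P j,
      (Real.exp (n ⟨x, μ⟩ + n ⟨x.shift μ, ν⟩ + n ⟨x.shift ν, μ⟩ + n ⟨x, ν⟩) - 1 -
        (n ⟨x, μ⟩ + n ⟨x.shift μ, ν⟩ + n ⟨x.shift ν, μ⟩ + n ⟨x, ν⟩)) ^ 2 ≤
      256 * (P.d : ℝ) * M₀ ^ 2 * ∑ b : PBond P j, n b ^ 2 := by
  have hpt : ∀ (μ ν : Fin P.d) (x : Site P j),
      (Real.exp (n ⟨x, μ⟩ + n ⟨x.shift μ, ν⟩ + n ⟨x.shift ν, μ⟩ + n ⟨x, ν⟩) - 1 -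
        (n ⟨x, μ⟩ + n ⟨x.shift μ, ν⟩ + n ⟨x.shift ν, μ⟩ + n ⟨x, ν⟩)) ^ 2 ≤
      64 * M₀ ^ 2 * (n ⟨x, μ⟩ ^ 2 + n ⟨x.shift μ, ν⟩ ^ 2 + n ⟨x.shift ν, μ⟩ ^ 2 + n ⟨x, ν⟩ ^ 2) :=
    fun μ ν x => sq_expRem_le _ _ _ _ M₀ (hn0 _) (hn0 _) (hn0 _) (hn0 _) (hn _) (hn _) (hn _) (hn _) hM4
  have hd : ((Finset.univ : Finset (Fin P.d)).card : ℝ) = (P.d : ℝ) := by rw [Finset.card_univ, Fintype.card_fin]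
  -- the four slot sums
  have hA : ∑ μ : Fin P.d, ∑ ν : Fin P.d, ∑ x : Site P j, n ⟨x, μ⟩ ^ 2 = (P.d : ℝ) * ∑ b : PBond P j, n b ^ 2 := by
    have : ∀ μ : Fin P.d, ∑ ν : Fin P.d, ∑ x : Site P j, n ⟨x, μ⟩ ^ 2 = (P.d : ℝ) * ∑ x : Site P j, n ⟨x, μ⟩ ^ 2 := by
      intro μ; rw [Finset.sum_const, nsmul_eq_mul, hd]
    simp_rw [this]
    rw [← Finset.mul_sum, Finset.sum_comm, sum_site_dir_eq_sum_bond (fun b => n b ^ 2)]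
  have hB : ∑ μ : Fin P.d, ∑ ν : Fin P.d, ∑ x : Site P j, n ⟨x.shift μ, ν⟩ ^ 2 = (P.d : ℝ) * ∑ b : PBond P j, n b ^ 2 := by
    have : ∀ μ ν : Fin P.d, ∑ x : Site P j, n ⟨x.shift μ, ν⟩ ^ 2 = ∑ x : Site P j, n ⟨x, ν⟩ ^ 2 :=
      fun μ ν => (LatticeFieldCalculus.shiftEquiv (P := P) (j := j) μ).sum_comp (fun x => n ⟨x, ν⟩ ^ 2)
    simp_rw [this]
    rw [Finset.sum_const, nsmul_eq_mul, hd, Finset.sum_comm, sum_site_dir_eq_sum_bond (fun b => n b ^ 2)]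
  have hC : ∑ μ : Fin P.d, ∑ ν : Fin P.d, ∑ x : Site P j, n ⟨x.shift ν, μ⟩ ^ 2 = (P.d : ℝ) * ∑ b : PBond P j, n b ^ 2 := by
    have : ∀ μ ν : Fin P.d, ∑ x : Site P j, n ⟨x.shift ν, μ⟩ ^ 2 = ∑ x : Site P j, n ⟨x, μ⟩ ^ 2 :=
      fun μ ν => (LatticeFieldCalculus.shiftEquiv (P := P) (j := j) ν).sum_comp (fun x => n ⟨x, μ⟩ ^ 2)
    simp_rw [this]
    exact hA
  have hD : ∑ μ : Fin P.d, ∑ ν : Fin P.d, ∑ x : Site P j, n ⟨x, ν⟩ ^ 2 = (P.d : ℝ) * ∑ b : PBond P j, n b ^ 2 := by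
    rw [Finset.sum_const, nsmul_eq_mul, hd, Finset.sum_comm, sum_site_dir_eq_sum_bond (fun b => n b ^ 2)]
  calc ∑ μ : Fin P.d, ∑ ν : Fin P.d, ∑ x : Site P j,
      (Real.exp (n ⟨x, μ⟩ + n ⟨x.shift μ, ν⟩ + n ⟨x.shift ν, μ⟩ + n ⟨x, ν⟩) - 1 -
        (n ⟨x, μ⟩ + n ⟨x.shift μ, ν⟩ + n ⟨x.shift ν, μ⟩ + n ⟨x, ν⟩)) ^ 2
      ≤ ∑ μ : Fin P.d, ∑ ν : Fin P.d, ∑ x : Site P j,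
          64 * M₀ ^ 2 * (n ⟨x, μ⟩ ^ 2 + n ⟨x.shift μ, ν⟩ ^ 2 + n ⟨x.shift ν, μ⟩ ^ 2 + n ⟨x, ν⟩ ^ 2) :=
        Finset.sum_le_sum fun μ _ => Finset.sum_le_sum fun ν _ => Finset.sum_le_sum fun x _ => hpt μ ν x
    _ = 64 * M₀ ^ 2 * (∑ μ : Fin P.d, ∑ ν : Fin P.d, ∑ x : Site P j, n ⟨x, μ⟩ ^ 2 +
          ∑ μ : Fin P.d, ∑ ν : Fin P.d, ∑ x : Site P j, n ⟨x.shift μ, ν⟩ ^ 2 +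
          ∑ μ : Fin P.d, ∑ ν : Fin P.d, ∑ x : Site P j, n ⟨x.shift ν, μ⟩ ^ 2 +
          ∑ μ : Fin P.d, ∑ ν : Fin P.d, ∑ x : Site P j, n ⟨x, ν⟩ ^ 2) := by
        simp only [Finset.mul_sum, Finset.sum_add_distrib, mul_add]
    _ = 256 * (P.d : ℝ) * M₀ ^ 2 * ∑ b : PBond P j, n b ^ 2 := by rw [hA, hB, hC, hD]; ring

end Rem

/-! ## §3 The junction energy `E_J` of ✓`Bsrc_split_le` (its third summand, text VERBATIM) -/

variable (F : T3Family)

/-- ★★★ **THE 0→1 JUNCTION ENERGY, BY KERNEL.**  For ANY chart tower `X` with finest sizes `‖X 0 b‖ ≤ M₀`, `4M₀ ≤ 1`, and ANY weights `w` with `0 ≤ w 1`,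
✓p839415 `Bsrc_split_le`'s third energy satisfies
`E_J ≤ 3·(w 1·L^{K−J−2}·(L⁴·(L³)⁻¹·(256·3·M₀²·Σ_{b : PBond (F.P K) 0} ‖X 0 b‖²)))` (`= 2304·w(1)·L^{K−J−1}·M₀²·Σ_b‖X 0 b‖²` when `K − J ≥ 2`):
only the source level `i = 0` contributes; the `Idx`-average is counted by ✓`sum_sq_idxAvg_le` (`L^{4−d}`, `d = 3`) and the remainder by ✓`sum_sq_rem_le`.
DOMAIN SENTENCE: against `purse ⊇ L^{−(K−J)}·Σ_ℓ‖ζ ℓ‖²` this is a purse-share iff `w(1)·M₀²·L^{2(K−J)−1}` is K-uniform — at the Thm-2 representative's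
`M₀ ≤ c·(L⁻¹)^{K−J}` that means `w 1 = O(1)` (NOT the SPEC weight `w 1 = L^{K−J−2}`, which leaves `L^{K−J−3}`).
[cite: Balaban1985Averaging, Prop. 4 (128)-(135) pp.37-38; Balaban1987RG1, (0.4), (0.11) p.253] -/
theorem junctionEnergy_le {J K : ℕ}
    (X : (i : ℕ) → PBond (F.P K) i → (specialUnitaryLogChart (Fin 2)).lie)
    (w : ℕ → ℝ) (hw : 0 ≤ w 1) (M₀ : ℝ) (hM0 : ∀ b : PBond (F.P K) 0, ‖X 0 b‖ ≤ M₀) (hM4 : 4 * M₀ ≤ 1) :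
      3 * ∑ i ∈ Finset.range (K - J), w (i + 1) * (F.L : ℝ) ^ (K - J - 1 - (i + 1)) *
          ∑ μ : Fin (F.P K).d, ∑ ν : Fin (F.P K).d, ∑ y' : Site (F.P K) (i + 1),
            (if i = 0 then ((Fintype.card (Idx (F.P K)) : ℝ)⁻¹ *
            ∑ a ∈ (Finset.univ : Finset (Idx (F.P K))) ×ˢ (Finset.range (F.P K).L ×ˢ Finset.range (F.P K).L),
              (Real.exp (‖X i ⟨(shiftN (shiftN (Site.blockSite y' a.1.1) μ a.2.1) ν a.2.2), μ⟩‖ + ‖X i ⟨((shiftN (shiftN (Site.blockSite y' a.1.1) μ a.2.1) ν a.2.2)).shift μ, ν⟩‖ + ‖X i ⟨((shiftN (shiftN (Site.blockSite y' a.1.1) μ a.2.1) ν a.2.2)).shift ν, μ⟩‖ + ‖X i ⟨(shiftN (shiftN (Site.blockSite y' a.1.1) μ a.2.1) ν a.2.2), ν⟩‖) - 1 - (‖X i ⟨(shiftN (shiftN (Site.blockSite y' a.1.1) μ a.2.1) ν a.2.2), μ⟩‖ + ‖X i ⟨((shiftN (shiftN (Site.blockSite y' a.1.1) μ a.2.1)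 ν a.2.2)).shift μ, ν⟩‖ + ‖X i ⟨((shiftN (shiftN (Site.blockSite y' a.1.1) μ a.2.1) ν a.2.2)).shift ν, μ⟩‖ + ‖X i ⟨(shiftN (shiftN (Site.blockSite y' a.1.1) μ a.2.1) ν a.2.2), ν⟩‖))) else 0) ^ 2 ≤
      3 * (w 1 * (F.L : ℝ) ^ (K - J - 1 - 1) * ((F.L : ℝ) ^ 4 * ((F.L : ℝ) ^ 3)⁻¹ *
        (256 * (3 : ℝ) * M₀ ^ 2 * ∑ b : PBond (F.P K) 0, ‖X 0 b‖ ^ 2))) := by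
  have hm : 0 + 1 ≤ (F.P K).m + (F.P K).K := by show 0 + 1 ≤ F.m + K; have := F.hm; omega
  have hL0 : (0 : ℝ) ≤ (F.L : ℝ) := Nat.cast_nonneg _
  have hRHS0 : 0 ≤ w 1 * (F.L : ℝ) ^ (K - J - 1 - 1) * ((F.L : ℝ) ^ 4 * ((F.L : ℝ) ^ 3)⁻¹ *
        (256 * (3 : ℝ) * M₀ ^ 2 * ∑ b : PBond (F.P K) 0, ‖X 0 b‖ ^ 2)) := by positivity
  refine mul_le_mul_of_nonneg_left ?_ (by norm_num)
  by_cases hKJ : K - J = 0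
  · have hr : Finset.range (K - J) = ∅ := by rw [hKJ, Finset.range_zero]
    rw [hr, Finset.sum_empty]
    exact hRHS0
  have h0mem : (0 : ℕ) ∈ Finset.range (K - J) := Finset.mem_range.2 (Nat.pos_of_ne_zero hKJ)
  rw [Finset.sum_eq_single_of_mem 0 h0mem (fun i _ hi0 => by simp [hi0])]
  simp only [↓reduceIte, Nat.zero_add]
  refine mul_le_mul_of_nonneg_left ?_ (mul_nonneg hw (pow_nonneg hL0 _))
  -- per (μ, ν): the `Idx`-average count, then the remainder energy
  have hd3 : (F.P K).d = 3 := T3Family.P_d F K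
  have hLL : ((F.P K).L : ℝ) = (F.L : ℝ) := rfl
  calc ∑ μ : Fin (F.P K).d, ∑ ν : Fin (F.P K).d, ∑ y' : Site (F.P K) 1,
          (((Fintype.card (Idx (F.P K)) : ℝ))⁻¹ *
            ∑ a ∈ (Finset.univ : Finset (Idx (F.P K))) ×ˢ (Finset.range (F.P K).L ×ˢ Finset.range (F.P K).L),
              (Real.exp (‖X 0 ⟨(shiftN (shiftN (Site.blockSite y' a.1.1) μ a.2.1) ν a.2.2), μ⟩‖ + ‖X 0 ⟨((shiftN (shiftN (Site.blockSite y' a.1.1) μ a.2.1) ν a.2.2)).shift μ, ν⟩‖ + ‖X 0 ⟨((shiftN (shiftN (Site.blockSite y' a.1.1) μ a.2.1) ν a.2.2)).shift ν, μ⟩‖ + ‖X 0 ⟨(shiftN (shiftN (Site.blockSite y' a.1.1) μ a.2.1) ν a.2.2), ν⟩‖) - 1 - (‖X 0 ⟨(shiftN (shiftN (Site.blockSite y' a.1.1) μ a.2.1) ν a.2.2), μ⟩‖ + ‖X 0 ⟨((shiftN (shiftN (Site.blockSite y' a.1.1) μ a.2.1) ν a.2.2)).shift μ, ν⟩‖ +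 ‖X 0 ⟨((shiftN (shiftN (Site.blockSite y' a.1.1) μ a.2.1) ν a.2.2)).shift ν, μ⟩‖ + ‖X 0 ⟨(shiftN (shiftN (Site.blockSite y' a.1.1) μ a.2.1) ν a.2.2), ν⟩‖))) ^ 2
      ≤ ∑ μ : Fin (F.P K).d, ∑ ν : Fin (F.P K).d, (((F.P K).L : ℝ) ^ 4 * (((F.P K).L : ℝ) ^ (F.P K).d)⁻¹ *
          ∑ x : Site (F.P K) 0, (Real.exp (‖X 0 ⟨x, μ⟩‖ + ‖X 0 ⟨x.shift μ, ν⟩‖ + ‖X 0 ⟨x.shift ν, μ⟩‖ + ‖X 0 ⟨x, ν⟩‖) - 1 -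
            (‖X 0 ⟨x, μ⟩‖ + ‖X 0 ⟨x.shift μ, ν⟩‖ + ‖X 0 ⟨x.shift ν, μ⟩‖ + ‖X 0 ⟨x, ν⟩‖)) ^ 2) :=
        Finset.sum_le_sum fun μ _ => Finset.sum_le_sum fun ν _ =>
          sum_sq_idxAvg_le (P := F.P K) (j := 0) hm μ ν
            (fun x => Real.exp (‖X 0 ⟨x, μ⟩‖ + ‖X 0 ⟨x.shift μ, ν⟩‖ + ‖X 0 ⟨x.shift ν, μ⟩‖ + ‖X 0 ⟨x, ν⟩‖) - 1 -
              (‖X 0 ⟨x, μ⟩‖ + ‖X 0 ⟨x.shift μ, ν⟩‖ + ‖X 0 ⟨x.shift ν, μ⟩‖ + ‖X 0 ⟨x, ν⟩‖))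
    _ = ((F.P K).L : ℝ) ^ 4 * (((F.P K).L : ℝ) ^ (F.P K).d)⁻¹ *
          ∑ μ : Fin (F.P K).d, ∑ ν : Fin (F.P K).d, ∑ x : Site (F.P K) 0,
            (Real.exp (‖X 0 ⟨x, μ⟩‖ + ‖X 0 ⟨x.shift μ, ν⟩‖ + ‖X 0 ⟨x.shift ν, μ⟩‖ + ‖X 0 ⟨x, ν⟩‖) - 1 -
              (‖X 0 ⟨x, μ⟩‖ + ‖X 0 ⟨x.shift μ, ν⟩‖ + ‖X 0 ⟨x.shift ν, μ⟩‖ + ‖X 0 ⟨x, ν⟩‖)) ^ 2 := by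
        simp only [Finset.mul_sum]
    _ ≤ ((F.P K).L : ℝ) ^ 4 * (((F.P K).L : ℝ) ^ (F.P K).d)⁻¹ * (256 * ((F.P K).d : ℝ) * M₀ ^ 2 * ∑ b : PBond (F.P K) 0, ‖X 0 b‖ ^ 2) :=
        mul_le_mul_of_nonneg_left (sum_sq_rem_le (fun b => ‖X 0 b‖) (fun b => norm_nonneg _) M₀ hM0 hM4) (by rw [hLL]; positivity)
    _ = (F.L : ℝ) ^ 4 * ((F.L : ℝ) ^ 3)⁻¹ * (256 * (3 : ℝ) * M₀ ^ 2 * ∑ b : PBond (F.P K) 0, ‖X 0 b‖ ^ 2) := by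
        rw [hLL, hd3]; push_cast; ring


/-! ## §4 Dock editions: the NAKED chart tower of ✓`linBudget_of_chartTower` (`hXdef`), and the purse currency -/

section Dock

open Literature.MathematicalPhysics.QuantumFieldTheory.Balaban1983to89.T4HaarSU2ExpChart (expPoint)
open Literature.MathematicalPhysics.QuantumFieldTheory.Balaban1983to89.T4ExpWindowSmallField (logVec)
open Literature.MathematicalPhysics.QuantumFieldTheory.Balaban1983to89.T3UnitLawDensityEML (ℰp)
open Literature.MathematicalPhysics.QuantumFieldTheory.Balaban1983to89.B10Eq18SigmaSU2 (su2Coord)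
open Literature.MathematicalPhysics.QuantumFieldTheory.Balaban1983to89.B10Eq18SigmaSU2Haar (rev)
open Literature.MathematicalPhysics.QuantumLattice (su2Quat)
open Summit.QuantumFields.YangMills.Theorems.FluctuationComparisonRegPrIntLS2BetaChartReadDescentOntoExpPoint (su2Coord_rev_mem_lie)
open Summit.QuantumFields.YangMills.Theorems.FluctuationComparisonRegPrIntLS2BetaCurlBudgetJunctionShare (norm_chartPoint)
open Summit.QuantumFields.YangMills.Theorems.FluctuationComparisonRegPrIntLS2BetaGeodesicJensenLift (norm_logVec_su2Quat_expPoint_le)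

/-- ★ At the finest level the naked chart tower reads the fluctuation itself: `‖X 0 ℓ‖ ≤ ‖ζ ℓ‖` (`Ū⁰ = id`, `e^ζU₀·U₀⁻¹ = e^ζ`, ✓`norm_chartPoint`,
✓`norm_logVec_su2Quat_expPoint_le`). [cite: Balaban1985Averaging, (19)-(20) p.21] -/
theorem norm_chartTower_zero_le {K : ℕ} (U₀ : GaugeField (F.P K) 0 (Matrix.specialUnitaryGroup (Fin 2) ℂ))
    (ζ : PBond (F.P K) 0 → EuclideanSpace ℝ (Fin 3))
    (X : (i : ℕ) → PBond (F.P K) i → (specialUnitaryLogChart (Fin 2)).lie)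
    (hXdef : X = fun (i : ℕ) (b : PBond (F.P K) i) =>
      (⟨su2Coord (rev (logVec (su2Quat (Averaging.iter (fun k => BlockAveraging.blockAvg (P := F.P K) (j := k) ℰp) i (fun ℓ => expPoint (ζ ℓ) * U₀ ℓ : GaugeField (F.P K) 0 (Matrix.specialUnitaryGroup (Fin 2) ℂ)) b * (Averaging.iter (fun k => BlockAveraging.blockAvg (P := F.P K) (j := k) ℰp) i U₀ b)⁻¹)))), su2Coord_rev_mem_lie _⟩ : (specialUnitaryLogChart (Fin 2)).lie))
    (ℓ : PBond (F.P K) 0) : ‖X 0 ℓ‖ ≤ ‖ζ ℓ‖ := by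
  subst hXdef
  rw [norm_chartPoint]
  show ‖logVec (su2Quat (expPoint (ζ ℓ) * U₀ ℓ * (U₀ ℓ)⁻¹))‖ ≤ ‖ζ ℓ‖
  rw [mul_inv_cancel_right]
  exact norm_logVec_su2Quat_expPoint_le _

/-- ★★ **THE JUNCTION ENERGY AT THE NAKED TOWER, IN PURSE CURRENCY.**  For ✓`linBudget_of_chartTower`'s `X` (`hXdef`) and a fluctuation with `‖ζ ℓ‖ ≤ M₀`, `4M₀ ≤ 1`:
`E_J ≤ (2304·w(1)·M₀²·L^{K−J−2}·L·L^{K−J})·purse`, `purse := (L⁻¹)^{K−J}·Σ_ℓ‖ζ ℓ‖² + L^{K−J}·REL` (REL `≥ 0` is only added).  DOMAIN SENTENCE (the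
weight): K-uniform iff `w(1)·M₀²·L^{2(K−J)−1} = O(1)` — at a representative with `M₀ ≤ c·(L⁻¹)^{K−J}` take **`w 1 := 1`** (`W ≤ 1 + L∕(L−1)`), NOT `w 1 = L^{K−J−2}`.
[cite: Balaban1985Averaging, Prop. 4 (128)-(135) pp.37-38; Balaban1987RG1, (0.4), (0.11) p.253] -/
theorem junctionEnergy_le_purse {J K : ℕ} (U₀ : GaugeField (F.P K) 0 (Matrix.specialUnitaryGroup (Fin 2) ℂ))
    (ζ : PBond (F.P K) 0 → EuclideanSpace ℝ (Fin 3))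
    (X : (i : ℕ) → PBond (F.P K) i → (specialUnitaryLogChart (Fin 2)).lie)
    (hXdef : X = fun (i : ℕ) (b : PBond (F.P K) i) =>
      (⟨su2Coord (rev (logVec (su2Quat (Averaging.iter (fun k => BlockAveraging.blockAvg (P := F.P K) (j := k) ℰp) i (fun ℓ => expPoint (ζ ℓ) * U₀ ℓ : GaugeField (F.P K) 0 (Matrix.specialUnitaryGroup (Fin 2) ℂ)) b * (Averaging.iter (fun k => BlockAveraging.blockAvg (P := F.P K) (j := k) ℰp) i U₀ b)⁻¹)))), su2Coord_rev_mem_lie _⟩ : (specialUnitaryLogChart (Fin 2)).lie))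
    (w : ℕ → ℝ) (hw : 0 ≤ w 1) (M₀ : ℝ) (hζM : ∀ ℓ : PBond (F.P K) 0, ‖ζ ℓ‖ ≤ M₀) (hM4 : 4 * M₀ ≤ 1) :
      3 * ∑ i ∈ Finset.range (K - J), w (i + 1) * (F.L : ℝ) ^ (K - J - 1 - (i + 1)) *
          ∑ μ : Fin (F.P K).d, ∑ ν : Fin (F.P K).d, ∑ y' : Site (F.P K) (i + 1),
            (if i = 0 then ((Fintype.card (Idx (F.P K)) : ℝ)⁻¹ *
            ∑ a ∈ (Finset.univ : Finset (Idx (F.P K))) ×ˢ (Finset.range (F.P K).L ×ˢ Finset.range (F.P K).L),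
              (Real.exp (‖X i ⟨(shiftN (shiftN (Site.blockSite y' a.1.1) μ a.2.1) ν a.2.2), μ⟩‖ + ‖X i ⟨((shiftN (shiftN (Site.blockSite y' a.1.1) μ a.2.1) ν a.2.2)).shift μ, ν⟩‖ + ‖X i ⟨((shiftN (shiftN (Site.blockSite y' a.1.1) μ a.2.1) ν a.2.2)).shift ν, μ⟩‖ + ‖X i ⟨(shiftN (shiftN (Site.blockSite y' a.1.1) μ a.2.1) ν a.2.2), ν⟩‖) - 1 - (‖X i ⟨(shiftN (shiftN (Site.blockSite y' a.1.1) μ a.2.1) ν a.2.2), μ⟩‖ + ‖X i ⟨((shiftN (shiftN (Site.blockSite y' a.1.1) μ a.2.1) ν a.2.2)).shift μ, ν⟩‖ + ‖X i ⟨((shiftN (shiftN (Site.blockSite y' a.1.1) μ a.2.1) ν a.2.2)).shift ν, μ⟩‖ + ‖X i ⟨(shiftN (shiftN (Site.blockSite y' a.1.1) μ a.2.1) ν a.2.2), ν⟩‖))) else 0) ^ 2 ≤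
      (2304 * w 1 * M₀ ^ 2 * ((F.L : ℝ) ^ (K - J - 1 - 1) * (F.L : ℝ) * (F.L : ℝ) ^ (K - J))) *
        (((F.L : ℝ)⁻¹) ^ (K - J) * ∑ ℓ : PBond (F.P K) 0, ‖ζ ℓ‖ ^ 2 +
          (F.L : ℝ) ^ (K - J) * ∑ p : Plaq (F.P K) 0,
            (1 - reTr ((GaugeField.plaqHol U₀ p)⁻¹ * GaugeField.plaqHol (fun ℓ => expPoint (ζ ℓ) * U₀ ℓ : GaugeField (F.P K) 0 (Matrix.specialUnitaryGroup (Fin 2) ℂ)) p))) := by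
  have hX0 : ∀ b : PBond (F.P K) 0, ‖X 0 b‖ ≤ M₀ := fun b => (norm_chartTower_zero_le F U₀ ζ X hXdef b).trans (hζM b)
  have h1 := junctionEnergy_le F (J := J) X w hw M₀ hX0 hM4
  have hL1 : (1 : ℝ) < (F.L : ℝ) := by exact_mod_cast F.hL.2
  have hL0 : (0 : ℝ) < (F.L : ℝ) := by linarith
  have hsum : ∑ b : PBond (F.P K) 0, ‖X 0 b‖ ^ 2 ≤ ∑ ℓ : PBond (F.P K) 0, ‖ζ ℓ‖ ^ 2 :=
    Finset.sum_le_sum fun b _ => pow_le_pow_left₀ (norm_nonneg _) (norm_chartTower_zero_le F U₀ ζ X hXdef b) 2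
  have hREL : 0 ≤ ∑ p : Plaq (F.P K) 0,
      (1 - reTr ((GaugeField.plaqHol U₀ p)⁻¹ * GaugeField.plaqHol (fun ℓ => expPoint (ζ ℓ) * U₀ ℓ : GaugeField (F.P K) 0 (Matrix.specialUnitaryGroup (Fin 2) ℂ)) p)) :=
    Finset.sum_nonneg fun p _ => sub_nonneg.2 (GaugeGroup.reTr_le_one _)
  have hpurse : ∑ ℓ : PBond (F.P K) 0, ‖ζ ℓ‖ ^ 2 ≤ (F.L : ℝ) ^ (K - J) *
      (((F.L : ℝ)⁻¹) ^ (K - J) * ∑ ℓ : PBond (F.P K) 0, ‖ζ ℓ‖ ^ 2 +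
          (F.L : ℝ) ^ (K - J) * ∑ p : Plaq (F.P K) 0,
            (1 - reTr ((GaugeField.plaqHol U₀ p)⁻¹ * GaugeField.plaqHol (fun ℓ => expPoint (ζ ℓ) * U₀ ℓ : GaugeField (F.P K) 0 (Matrix.specialUnitaryGroup (Fin 2) ℂ)) p))) := by
    have hinv : (F.L : ℝ) ^ (K - J) * ((F.L : ℝ)⁻¹) ^ (K - J) = 1 := by rw [inv_pow, mul_inv_cancel₀ (pow_ne_zero _ hL0.ne')]
    have hpow : 0 ≤ (F.L : ℝ) ^ (K - J) := pow_nonneg hL0.le _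
    calc ∑ ℓ : PBond (F.P K) 0, ‖ζ ℓ‖ ^ 2 = 1 * ∑ ℓ : PBond (F.P K) 0, ‖ζ ℓ‖ ^ 2 + 0 := by ring
      _ ≤ ((F.L : ℝ) ^ (K - J) * ((F.L : ℝ)⁻¹) ^ (K - J)) * ∑ ℓ : PBond (F.P K) 0, ‖ζ ℓ‖ ^ 2 +
          (F.L : ℝ) ^ (K - J) * ((F.L : ℝ) ^ (K - J) * ∑ p : Plaq (F.P K) 0,
            (1 - reTr ((GaugeField.plaqHol U₀ p)⁻¹ * GaugeField.plaqHol (fun ℓ => expPoint (ζ ℓ) * U₀ ℓ : GaugeField (F.P K) 0 (Matrix.specialUnitaryGroup (Fin 2) ℂ)) p))) :=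
          add_le_add (by rw [hinv]) (mul_nonneg hpow (mul_nonneg hpow hREL))
      _ = _ := by ring
  have h43 : (F.L : ℝ) ^ 4 * ((F.L : ℝ) ^ 3)⁻¹ = (F.L : ℝ) := by field_simp
  rw [h43] at h1
  refine h1.trans ?_
  have hc0 : 0 ≤ 2304 * w 1 * M₀ ^ 2 * ((F.L : ℝ) ^ (K - J - 1 - 1) * (F.L : ℝ)) := by positivity
  calc 3 * (w 1 * (F.L : ℝ) ^ (K - J - 1 - 1) * ((F.L : ℝ) * (256 * (3 : ℝ) * M₀ ^ 2 * ∑ b : PBond (F.P K) 0, ‖X 0 b‖ ^ 2)))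
      = (2304 * w 1 * M₀ ^ 2 * ((F.L : ℝ) ^ (K - J - 1 - 1) * (F.L : ℝ))) * ∑ b : PBond (F.P K) 0, ‖X 0 b‖ ^ 2 := by ring
    _ ≤ (2304 * w 1 * M₀ ^ 2 * ((F.L : ℝ) ^ (K - J - 1 - 1) * (F.L : ℝ))) * ((F.L : ℝ) ^ (K - J) *
      (((F.L : ℝ)⁻¹) ^ (K - J) * ∑ ℓ : PBond (F.P K) 0, ‖ζ ℓ‖ ^ 2 +
          (F.L : ℝ) ^ (K - J) * ∑ p : Plaq (F.P K) 0,
            (1 - reTr ((GaugeField.plaqHol U₀ p)⁻¹ * GaugeField.plaqHol (fun ℓ => expPoint (ζ ℓ) * U₀ ℓ : GaugeField (F.P K) 0 (Matrix.specialUnitaryGroup (Fin 2) ℂ)) p)))) :=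
        mul_le_mul_of_nonneg_left (hsum.trans hpurse) hc0
    _ = _ := by ring

end Dock

end Summit.QuantumFields.YangMills.Theorems.FluctuationComparisonRegPrIntLS2BetaJunctionEnergy

end
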